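/-
Copyright (c) 2026 the pub-hodgecm-mathlib formalisation cell (harness21).  Prover seat hodgecm-mathlib-K2E1-p15 (g3), Track B ∕ K2-LIT, h413 = `stmt-HodgeConjecture-24833`,
R90-TF section S8 «ContSpec-n½» (deal (A) 2026-09-04T16:23:19Z, ruling S8-R14 (iii)): LAYER 2 PRINT of the #4′ road at Mok's quasi-split datum `U(J₂) = quasiSplit L⁺ L c 2` — ★ C7 HEAD″ p861008
plugged BY NAME as the exhaustion letter, the block-structure letters (E_blk)(O)(N_blk), the density letter (D) and the atom letter (L) kept open by name.
-/
import Summits.HodgeConjecture.HodgeConjecture.Theorems.R90S8ResidualLeClosureOfLevelLetters                 -- ★ p862066 (this seat): `residual_le_topologicalClosure_of_level_letters`; brings ★ LAYER 1, ★ `residualSubspace`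
import Summits.HodgeConjecture.HodgeConjecture.Theorems.K2E1PseudoEisensteinFamilyDecompositionOpenCosetsU2    -- ★ HEAD″ p861008 (K2E1-p12): `blocks_open` (exhaustion of `Wcᗮ ∩ L²^{(K′,ω)}` by the closed spans of the `χ`-families, no finiteness)
import Literature.NumberTheory.Automorphic.UnitaryGroupDetCharacter                                          -- ★ `cmDetChar` (`ψ∘det` as an automorphic character)
import Literature.NumberTheory.Automorphic.AutomorphicCharacterLine                                          -- ★ `AutomorphicCharacter.lineSubrep`
import HarnessLib

/-!
# S8 #4′ road, LAYER 2 PRINT — `R90S8ResHLeClosureCharLinesOfLetters`: an irreducible closed subrepresentation of `L²_res(U(J₂)_{L∕L⁺})` lies in the closed span of the character lines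
# `ℂ·[ψ∘det]`, MODULO the named level letters (density (D), block structure (E_blk)(O)(N_blk) = the level self-dual package «G9», atoms (L) = ★ (B)), with the EXHAUSTION discharged by ★ HEAD″

Track B ∕ K2-LIT, crux h413 = `stmt-HodgeConjecture-24833`, route of record `HCCMUnconditional`; cell `hodgecm-mathlib`, R90-TF programme, section S8 «ContSpec-n½», socket #4′
`sock_S8_resH_spannedByCharLines` of `Lines/R90_S8_ResidualSpectrumU3B.lean` («`L²_res(U(Φ₂)) ≤ closure ⨆_ψ ℂ·(ψ∘det)`»).  THEOREMS ONLY (no `def`, no `instance`, no `notation`, no named-fact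
hypothesis, no `sorry`; default heartbeats); lane `--supports stmt-HodgeConjecture-24833 --as helper` (count-neutral).  CLOSES NO SOCKET: the conclusion is the socket's inequality on Mok's
spelling `quasiSplit L⁺ L c 2 = cmDatum L 2 ((antidiagonal 2).over L)` (`rfl`) for ANY family of unipotent radicals `𝔓` equal to `N(𝔸)` and ANY irreducible `P ≤ residualSubspace _ μ 𝔓`; the
literal-`Φ₂` ∕ `cmResidualSubspaceR` ∕ `charLine₂` bytes of B are reached by the consumer through ★ `antidiagOne_eq_over` exactly as ★ (B) `mem_iSup_lineSubrep_cmDetChar_of_ae_eq` does.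

THE LETTERS (S8-R14 (iii); index `i : ι` = a level∕`K`-type `(K′ i, ω i)` with the C7 HEAD″ side conditions; block index `b` = a Hecke character `χ` with `χ|_{ℝ_{>0}} = 1` and `V(χ, K′ i, ω i) ≠ ⊥`):
* discharged here BY NAME: (HEAD) ★ `blocks_open` — `(L²_cusp)ᗮ ∩ L²^{(K′,ω)} ≤ closure ⨆_χ Blk χ`, `Blk χ = closure span {[E(f(H)·φ)] : f ∈ C_c((0,∞)), φ ∈ V(χ,K′,ω)}`, given its own
  hypotheses `hdo ∕ hHK′ ∕ hW` (★ p861020 at `K_∞·K_max,f`, every `K_∞·K′_f`) and `hP1τ` (★ P1b_τ p860930 at compact `K′`), all passed through per index; and `L²_res ⟂ L²_cusp` (★).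
* kept OPEN by name: (D) `hD` density of the isotypic pieces of `P`; (E_blk) `hEblk : Blk ≤ closure (At ⊔ Ln)`; (O) `hO : (⨆ At) ⟂ (⨆ Ln)` per level (★ `isOrtho_iSup_atoms_lines_of_blocks` from
  (O_blk) + ★ R6); (N_blk) `hN` no line mass for irreducibles of `L²_res` (D5′); (L) `hL : At ≤ ⨆_ψ ℂ·[ψ∘det]` — with `At χ := span {residue classes}` (S8-R14 (i)) this is ★ (B)
  p861962 `span_le_iSup_charLine₂_of_forall_ae_eq` ∘ p862022 §2 per block (modulo T2 FINAL's letters and `hsrc`).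
* §1 **`residual_le_topologicalClosure_iSup_charLines_of_letters`** — THE PRINT.
HONEST LABEL: HC_CM is proved only modulo the 7 printed citations (2 remaining named inputs: hLiu418 = `stmt-HodgeConjecture-24832`, h413 = `stmt-HodgeConjecture-24833`) until
rung 0 closes; REL ≠ ★ ≠ BUILT; this file asserts no named fact, is conditional by construction on its visible binders, and closes no socket (#4′ stays OPEN modulo G9 + (D) + `hsrc`); count-neutral.

## References
* [MoeglinWaldspurger1995] C. Mœglin, J.-L. Waldspurger, *Spectral Decomposition and Eisenstein Series* (1995), I.2.18, II.1.1–II.1.4, II.2.4, V.3.13.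
* [Rogawski1990] J. D. Rogawski, *Automorphic Representations of Unitary Groups in Three Variables* (1990), §13.9 p. 229 («the discrete non-cuspidal spectrum is spanned by the residues of Eisenstein series»), §13.3 p. 202.
-/

set_option autoImplicit false
set_option linter.dupNamespace false  -- the mandated namespace `…HodgeConjecture.HodgeConjecture.R90.S8` (LEAD #1 L1) repeats the summit's segment

noncomputable section

open MeasureTheory Measure Set Filter Topology NumberField
open Literature.MeasureTheory.Group Literature.NumberTheory.Automorphic Literature.NumberTheory.Automorphic.UnitaryGroup Literature.NumberTheory.GaloisRepresentations AdelicGroupData ContRepresentation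
open Literature.NumberTheory.Automorphic.Arthur2013.Leaves.TECR
open Summit.HodgeConjecture.HodgeConjecture.Cruxes.H413.K2E1BorelEisensteinU
open Summit.HodgeConjecture.HodgeConjecture.Cruxes.H413.K2E1CharacterEisensteinU2Defs
open Summit.HodgeConjecture.HodgeConjecture.Cruxes.H413.K2E1ChiSectionSpaceU2Defs
open Summit.HodgeConjecture.HodgeConjecture.Cruxes.H413.K2E1PseudoEisensteinFamilyDecompositionOpenCosetsU2 (blocks_open)
open Summit.HodgeConjecture.HodgeConjecture.Cruxes.H413.K2E1CuspidalSpectrumUnitary (residualSubspace)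
open scoped ENNReal NNReal Pointwise

namespace Summit.HodgeConjecture.HodgeConjecture.R90.S8

variable (L : Type) [Field L] [NumberField L] [IsCMField L]
  (μ : Measure (quasiSplit (↥(maximalRealSubfield L)) L (IsCMField.complexConj L) 2).automorphicQuotient)

/-! ## §1 The print -/

/-- **LAYER 2 PRINT — an irreducible of `L²_res(U(J₂))` lies in `closure ⨆_ψ ℂ·[ψ∘det]` modulo the named level letters**, exhaustion by ★ HEAD″ `blocks_open` at every index `i = (K′ i, ω i)`
(its side conditions `hdo∕hHK′∕hW∕hP1τ` passed through), `L²_res ⟂ L²_cusp` (★), and ★ `residual_le_topologicalClosure_of_level_letters` (LAYER 2 generic ∘ LAYER 1).  Open letters BY NAME: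
(D) `hD`, (E_blk) `hEblk`, (O) `hO`, (N_blk) `hN`, (L) `hL` (= ★ (B) once `At := span {residue classes}`). [cite: MoeglinWaldspurger1995, I.2.18, II.2.4, V.3.13] [cite: Rogawski1990, §13.9 p. 229] -/
theorem residual_le_topologicalClosure_iSup_charLines_of_letters (hc : IsCMField.complexConj L * IsCMField.complexConj L = 1)
    [MeasurableSpace (quasiSplit (↥(maximalRealSubfield L)) L (IsCMField.complexConj L) 2).Adelic] [BorelSpace (quasiSplit (↥(maximalRealSubfield L)) L (IsCMField.complexConj L) 2).Adelic] [(quasiSplit (↥(maximalRealSubfield L)) L (IsCMField.complexConj L) 2).IsAutomorphicMeasure μ]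
    (𝔓 : (quasiSplit (↥(maximalRealSubfield L)) L (IsCMField.complexConj L) 2).ParabolicUnipotentData) (h𝔓 : ∀ j : 𝔓.ι, 𝔓.radical j = adelicUnipotent (↥(maximalRealSubfield L)) L (IsCMField.complexConj L) 2)
    {ι : Type*} (K' : ι → Subgroup (quasiSplit (↥(maximalRealSubfield L)) L (IsCMField.complexConj L) 2).Adelic)
    (hdo : ∀ (ℓ : ι) (w' : (quasiSplit (↥(maximalRealSubfield L)) L (IsCMField.complexConj L) 2).Adelic), IsOpen (DoubleCoset.doubleCoset w' (borelAdelic (↥(maximalRealSubfield L)) L (IsCMField.complexConj L) 2 : Set (quasiSplit (↥(maximalRealSubfield L)) L (IsCMField.complexConj L) 2).Adelic) (K' ℓ)))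
    (hHK' : ∀ (ℓ : ι) (g k : (quasiSplit (↥(maximalRealSubfield L)) L (IsCMField.complexConj L) 2).Adelic), k ∈ K' ℓ → borelHeight (g * k) = borelHeight g)
    (W : ι → Finset (quasiSplit (↥(maximalRealSubfield L)) L (IsCMField.complexConj L) 2).Adelic) (hW : ∀ (ℓ : ι) (g : (quasiSplit (↥(maximalRealSubfield L)) L (IsCMField.complexConj L) 2).Adelic), ∃ β ∈ borelAdelic (↥(maximalRealSubfield L)) L (IsCMField.complexConj L) 2, ∃ w ∈ W ℓ, ∃ k ∈ K' ℓ, g = β * w * k)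
    (ω : ∀ ℓ : ι, ↥(K' ℓ) →* ℂ) (hω1 : ∀ (ℓ : ι) (k : ↥(K' ℓ)), ‖ω ℓ k‖ = 1)
    (hP1τ : ∀ ℓ : ι, (((quasiSplit (↥(maximalRealSubfield L)) L (IsCMField.complexConj L) 2).cuspidalSubspace μ 𝔓).toSubmodule)ᗮ ⊓ (⨅ k : ↥(K' ℓ), Module.End.eigenspace ((((quasiSplit (↥(maximalRealSubfield L)) L (IsCMField.complexConj L) 2).rightRegular μ) ((K' ℓ).subtype k) : (quasiSplit (↥(maximalRealSubfield L)) L (IsCMField.complexConj L) 2).L2 μ →L[ℂ] (quasiSplit (↥(maximalRealSubfield L)) L (IsCMField.complexConj L) 2).L2 μ) :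
        (quasiSplit (↥(maximalRealSubfield L)) L (IsCMField.complexConj L) 2).L2 μ →ₗ[ℂ] (quasiSplit (↥(maximalRealSubfield L)) L (IsCMField.complexConj L) 2).L2 μ) (ω ℓ k)) =
      (Submodule.span ℂ {f : (quasiSplit (↥(maximalRealSubfield L)) L (IsCMField.complexConj L) 2).L2 μ | ∃ (i : 𝔓.ι) (Φ : (quasiSplit (↥(maximalRealSubfield L)) L (IsCMField.complexConj L) 2).Adelic → ℂ) (_ : Measurable Φ)
        (_ : ∀ (g : (quasiSplit (↥(maximalRealSubfield L)) L (IsCMField.complexConj L) 2).Adelic) (n : 𝔓.radical i), Φ (g * n) = Φ g)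
        (_ : ∫⁻ x, (∑' q : (quasiSplit (↥(maximalRealSubfield L)) L (IsCMField.complexConj L) 2).quotientSubgroup ⧸ (𝔓.radical i).subgroupOf (quasiSplit (↥(maximalRealSubfield L)) L (IsCMField.complexConj L) 2).quotientSubgroup,
          ‖Φ ((Quotient.out x : (quasiSplit (↥(maximalRealSubfield L)) L (IsCMField.complexConj L) 2).Adelic) * ((q.out : (quasiSplit (↥(maximalRealSubfield L)) L (IsCMField.complexConj L) 2).quotientSubgroup) : (quasiSplit (↥(maximalRealSubfield L)) L (IsCMField.complexConj L) 2).Adelic))‖ₑ) ^ 2 ∂μ < ∞)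
        (_ : Continuous Φ) (_ : ∃ M : ℝ, ∀ g, ‖Φ g‖ ≤ M) (_ : ∃ C : Set (quasiSplit (↥(maximalRealSubfield L)) L (IsCMField.complexConj L) 2).Adelic, IsCompact C ∧ ∀ g, g ∉ C * ((𝔓.radical i : Subgroup (quasiSplit (↥(maximalRealSubfield L)) L (IsCMField.complexConj L) 2).Adelic) : Set (quasiSplit (↥(maximalRealSubfield L)) L (IsCMField.complexConj L) 2).Adelic) → Φ g = 0)
        (_ : ∀ (k : ↥(K' ℓ)) (h : (quasiSplit (↥(maximalRealSubfield L)) L (IsCMField.complexConj L) 2).Adelic), Φ ((K' ℓ).subtype k * h) = (ω ℓ k)⁻¹ * Φ h)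
        (hθ : MemLp (fun x : (quasiSplit (↥(maximalRealSubfield L)) L (IsCMField.complexConj L) 2).automorphicQuotient => ∑' q : (quasiSplit (↥(maximalRealSubfield L)) L (IsCMField.complexConj L) 2).quotientSubgroup ⧸ (𝔓.radical i).subgroupOf (quasiSplit (↥(maximalRealSubfield L)) L (IsCMField.complexConj L) 2).quotientSubgroup,
          Φ ((Quotient.out x : (quasiSplit (↥(maximalRealSubfield L)) L (IsCMField.complexConj L) 2).Adelic) * ((q.out : (quasiSplit (↥(maximalRealSubfield L)) L (IsCMField.complexConj L) 2).quotientSubgroup) : (quasiSplit (↥(maximalRealSubfield L)) L (IsCMField.complexConj L) 2).Adelic))) 2 μ), f = hθ.toLp _}).topologicalClosure)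
    (P : ClosedSubrep ((quasiSplit (↥(maximalRealSubfield L)) L (IsCMField.complexConj L) 2).rightRegular μ)) (hP : P.toContRep.IsTopIrreducible) (hPres : P ≤ residualSubspace (quasiSplit (↥(maximalRealSubfield L)) L (IsCMField.complexConj L) 2) μ 𝔓)
    (At Ln : ∀ ℓ : ι, ↥{χ : HeckeCharacter L | (∀ r : ℝ≥0ˣ, χ (posRealIdele L r) = 1) ∧ chiSectionSpace χ (K' ℓ) (ω ℓ : ↥(K' ℓ) → ℂ) ≠ ⊥} → Submodule ℂ ((quasiSplit (↥(maximalRealSubfield L)) L (IsCMField.complexConj L) 2).L2 μ))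
    (hD : P.toSubmodule ≤ (⨆ ℓ : ι, P.toSubmodule ⊓ (⨅ k : ↥(K' ℓ), Module.End.eigenspace ((((quasiSplit (↥(maximalRealSubfield L)) L (IsCMField.complexConj L) 2).rightRegular μ) ((K' ℓ).subtype k) : (quasiSplit (↥(maximalRealSubfield L)) L (IsCMField.complexConj L) 2).L2 μ →L[ℂ] (quasiSplit (↥(maximalRealSubfield L)) L (IsCMField.complexConj L) 2).L2 μ) :
          (quasiSplit (↥(maximalRealSubfield L)) L (IsCMField.complexConj L) 2).L2 μ →ₗ[ℂ] (quasiSplit (↥(maximalRealSubfield L)) L (IsCMField.complexConj L) 2).L2 μ) (ω ℓ k))).topologicalClosure)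
    (hEblk : ∀ (ℓ : ι) (b : ↥{χ : HeckeCharacter L | (∀ r : ℝ≥0ˣ, χ (posRealIdele L r) = 1) ∧ chiSectionSpace χ (K' ℓ) (ω ℓ : ↥(K' ℓ) → ℂ) ≠ ⊥}),
      (Submodule.span ℂ {v : (quasiSplit (↥(maximalRealSubfield L)) L (IsCMField.complexConj L) 2).L2 μ |
            ∃ (f : ℝ → ℂ) (_ : Continuous f) (_ : HasCompactSupport f) (_ : tsupport f ⊆ Ioi 0)
              (φ : (quasiSplit (↥(maximalRealSubfield L)) L (IsCMField.complexConj L) 2).Adelic → ℂ) (_ : φ ∈ chiSectionSpace (b : HeckeCharacter L) (K' ℓ) (ω ℓ : ↥(K' ℓ) → ℂ)) (_ : Continuous φ)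
              (hv : MemLp ((quasiSplit (↥(maximalRealSubfield L)) L (IsCMField.complexConj L) 2).quotFun (eisensteinSeriesU (fun g => f (borelHeight g) * φ g))) 2 μ), v = hv.toLp _}).topologicalClosure ≤ (At ℓ b ⊔ Ln ℓ b).topologicalClosure)
    (hO : ∀ ℓ : ι, (⨆ b, At ℓ b) ⟂ (⨆ b, Ln ℓ b))
    (hN : ∀ (ℓ : ι) (b : ↥{χ : HeckeCharacter L | (∀ r : ℝ≥0ˣ, χ (posRealIdele L r) = 1) ∧ chiSectionSpace χ (K' ℓ) (ω ℓ : ↥(K' ℓ) → ℂ) ≠ ⊥}) (W' : ClosedSubrep ((quasiSplit (↥(maximalRealSubfield L)) L (IsCMField.complexConj L) 2).rightRegular μ)),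
      W'.toContRep.IsTopIrreducible → W' ≤ residualSubspace (quasiSplit (↥(maximalRealSubfield L)) L (IsCMField.complexConj L) 2) μ 𝔓 → W'.toSubmodule ⊓ (⨅ k : ↥(K' ℓ), Module.End.eigenspace ((((quasiSplit (↥(maximalRealSubfield L)) L (IsCMField.complexConj L) 2).rightRegular μ) ((K' ℓ).subtype k) : (quasiSplit (↥(maximalRealSubfield L)) L (IsCMField.complexConj L) 2).L2 μ →L[ℂ] (quasiSplit (↥(maximalRealSubfield L)) L (IsCMField.complexConj L) 2).L2 μ) :
          (quasiSplit (↥(maximalRealSubfield L)) L (IsCMField.complexConj L) 2).L2 μ →ₗ[ℂ] (quasiSplit (↥(maximalRealSubfield L)) L (IsCMField.complexConj L) 2).L2 μ) (ω ℓ k)) ≤ (Ln ℓ b)ᗮ)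
    (hL : ∀ (ℓ : ι) (b : ↥{χ : HeckeCharacter L | (∀ r : ℝ≥0ˣ, χ (posRealIdele L r) = 1) ∧ chiSectionSpace χ (K' ℓ) (ω ℓ : ↥(K' ℓ) → ℂ) ≠ ⊥}), At ℓ b ≤ (⨆ ψ : {ψ : ↥(TorusDict.torus (IsCMField.complexConj L)) →ₜ* ℂˣ // TorusDict.IsAutomorphic (IsCMField.complexConj L) ψ},
        (AdelicGroupData.AutomorphicCharacter.lineSubrep (𝒢 := (quasiSplit (↥(maximalRealSubfield L)) L (IsCMField.complexConj L) 2))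
          (cmDetChar L 2 ((StdForm.antidiagonal 2).over L) ψ.1 ψ.2 ((Matrix.isUnit_iff_isUnit_det _).mp (StdForm.isUnit_over (StdForm.antidiagonal 2) L)).ne_zero) μ).toSubmodule)) :
    P.toSubmodule ≤ (⨆ ψ : {ψ : ↥(TorusDict.torus (IsCMField.complexConj L)) →ₜ* ℂˣ // TorusDict.IsAutomorphic (IsCMField.complexConj L) ψ},
        (AdelicGroupData.AutomorphicCharacter.lineSubrep (𝒢 := (quasiSplit (↥(maximalRealSubfield L)) L (IsCMField.complexConj L) 2))
          (cmDetChar L 2 ((StdForm.antidiagonal 2).over L) ψ.1 ψ.2 ((Matrix.isUnit_iff_isUnit_det _).mp (StdForm.isUnit_over (StdForm.antidiagonal 2) L)).ne_zero) μ).toSubmodule).topologicalClosure := by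
  refine residual_le_topologicalClosure_of_level_letters (quasiSplit (↥(maximalRealSubfield L)) L (IsCMField.complexConj L) 2) μ 𝔓 P hP hPres
    (fun ℓ : ι => (⨅ k : ↥(K' ℓ), Module.End.eigenspace ((((quasiSplit (↥(maximalRealSubfield L)) L (IsCMField.complexConj L) 2).rightRegular μ) ((K' ℓ).subtype k) : (quasiSplit (↥(maximalRealSubfield L)) L (IsCMField.complexConj L) 2).L2 μ →L[ℂ] (quasiSplit (↥(maximalRealSubfield L)) L (IsCMField.complexConj L) 2).L2 μ) :
          (quasiSplit (↥(maximalRealSubfield L)) L (IsCMField.complexConj L) 2).L2 μ →ₗ[ℂ] (quasiSplit (↥(maximalRealSubfield L)) L (IsCMField.complexConj L) 2).L2 μ) (ω ℓ k)))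
    (fun (ℓ : ι) (b : ↥{χ : HeckeCharacter L | (∀ r : ℝ≥0ˣ, χ (posRealIdele L r) = 1) ∧ chiSectionSpace χ (K' ℓ) (ω ℓ : ↥(K' ℓ) → ℂ) ≠ ⊥}) => (Submodule.span ℂ {v : (quasiSplit (↥(maximalRealSubfield L)) L (IsCMField.complexConj L) 2).L2 μ |
            ∃ (f : ℝ → ℂ) (_ : Continuous f) (_ : HasCompactSupport f) (_ : tsupport f ⊆ Ioi 0)
              (φ : (quasiSplit (↥(maximalRealSubfield L)) L (IsCMField.complexConj L) 2).Adelic → ℂ) (_ : φ ∈ chiSectionSpace (b : HeckeCharacter L) (K' ℓ) (ω ℓ : ↥(K' ℓ) → ℂ)) (_ : Continuous φ)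
              (hv : MemLp ((quasiSplit (↥(maximalRealSubfield L)) L (IsCMField.complexConj L) 2).quotFun (eisensteinSeriesU (fun g => f (borelHeight g) * φ g))) 2 μ), v = hv.toLp _}).topologicalClosure)
    At Ln _ hD (fun ℓ => ?_) hEblk hO hN hL
  exact (blocks_open L μ hc 𝔓 h𝔓 (K' ℓ) (hdo ℓ) (hHK' ℓ) (W ℓ) (hW ℓ) (ω ℓ) (hω1 ℓ) ((quasiSplit (↥(maximalRealSubfield L)) L (IsCMField.complexConj L) 2).cuspidalSubspace μ 𝔓) (hP1τ ℓ)).2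

end Summit.HodgeConjecture.HodgeConjecture.R90.S8

end
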